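import Mathlib.AlgebraicGeometry.PullbackCarrier
import Mathlib.Algebra.Category.Ring.Constructions
import HarnessLib

/-!
# Crux `NoZenoR` (stmt-ResolutionOfSingularities-19943), slot 5 `stub_L1wCoreF3`, seam2 (m3) — (S2a-sch) POINTS OF A
# FIBRE PRODUCT OVER A PAIR OF POINTS: `Spec (κ(y) ⊗_{κ(z)} κ(z₁))` injects into the points of `X¹ ×_X X_f` over `(y, z₁)`

OURS (cell res-hironaka, chain W4.4; stub worker res-L0-w44-stub-4 g8; piece (S2a-sch) of res-L0-w44-plan-1 DESK WORD 20
(b): the scheme wrapper for res-D-pv-039's (S2a) point count).  Nothing here is a statement of the manuscript under review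
(Hironaka 2017); AI-written, weaker than expert review; def-free, fact-free — a repackaging of Mathlib's description of
the underlying set of a fibre product (`AlgebraicGeometry.Scheme.Pullback.carrierEquiv`, `Triplet.SpecTensorTo`).

For a cartesian square `P ⟶ X¹`, `P ⟶ X_f` over `ρ : X¹ ⟶ X`, `σ : X_f ⟶ X` (`IsPullback p₁ p₂ ρ σ`; in slot 5:
`X¹_f = X¹ ×_X X_f`, the base change of the node blow-up along the splitting base) and points `y ∈ X¹`, `z₁ ∈ X_f`
over the same `z = ρ y = σ z₁`:

* `specTensorTo_base_injective` — the canonical `Spec (κ(y) ⊗_{κ(z)} κ(z₁)) ⟶ X¹ ×_X X_f` (Mathlib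
  `Triplet.SpecTensorTo`) is INJECTIVE on points, landing over `y` and `z₁`;
* `exists_ne_over_of_isPullback` — two distinct points of `Spec (κ(y) ⊗_{κ(z)} κ(z₁))` give two distinct points of `P`
  over `y` and `z₁`;
* `nonempty_tensor_iso_tensorProduct` — Mathlib's pushout ring `Triplet.tensor` IS `κ(y) ⊗[κ(ρ y)] κ(z₁)` (algebras
  `ρ.residueFieldMap y` and `κ(ρ y) ≅ κ(σ z₁) → κ(z₁)`), so that
* **`exists_ne_over_of_isPullback_of_primeSpectrum`** — two distinct primes of the ring `κ(y) ⊗[κ(ρ y)] κ(z₁)`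
  (res-D-pv-039's (S2a) output) give two distinct points `y₁ ≠ y₂` of `P` with `p₁ yᵢ = y`, `p₂ yᵢ = z₁`.

References: A. Grothendieck, EGA I (1971) 3.4.9 / The Stacks Project, Tag 01JT (points of fibre products)
[`StacksProject`].
-/

noncomputable section

-- single-problem summit: the doubled namespace component `ResolutionOfSingularities` is forced
set_option linter.dupNamespace false

namespace Summit.ResolutionOfSingularities.ResolutionOfSingularities.Theorems.NoZeno.ExcCount

open CategoryTheory CategoryTheory.Limits AlgebraicGeometry TopologicalSpace
open AlgebraicGeometry.Scheme.Pullback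
open scoped TensorProduct

universe u

section FibrePoints

variable {X1 Xf X : Scheme.{u}} {ρ : X1 ⟶ X} {σ : Xf ⟶ X}

/-- **`Spec (κ(y) ⊗_{κ(s)} κ(z₁)) → X¹ ×_X X_f` is injective on points** (Mathlib `carrierEquiv`). [cite: StacksProject, Tag 01JT] -/
theorem specTensorTo_base_injective (T : Triplet ρ σ) : Function.Injective (T.SpecTensorTo).base := by
  intro p q hpq
  have h : (carrierEquiv (f := ρ) (g := σ)).symm ⟨T, p⟩ = (carrierEquiv (f := ρ) (g := σ)).symm ⟨T, q⟩ := hpq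
  have h' := (carrierEquiv (f := ρ) (g := σ)).symm.injective h
  simp only [Sigma.mk.injEq, heq_eq_eq, true_and] at h'
  exact h'

/-- **Two distinct points of `Spec (κ(y) ⊗_{κ(s)} κ(z₁))` give two distinct points of any fibre product `P` over
`(y, z₁)`.** [cite: StacksProject, Tag 01JT] -/
theorem exists_ne_over_of_isPullback {P : Scheme.{u}} {p₁ : P ⟶ X1} {p₂ : P ⟶ Xf} (hP : IsPullback p₁ p₂ ρ σ)
    (T : Triplet ρ σ) {q q' : Spec T.tensor} (hqq : q ≠ q') :
    ∃ y₁ y₂ : P, y₁ ≠ y₂ ∧ p₁.base y₁ = T.x ∧ p₁.base y₂ = T.x ∧ p₂.base y₁ = T.y ∧ p₂.base y₂ = T.y := by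
  let e := hP.isoPullback
  have hinj : Function.Injective e.inv.base := (TopCat.homeoOfIso (Scheme.forgetToTop.mapIso e.symm)).injective
  refine ⟨e.inv.base (T.SpecTensorTo.base q), e.inv.base (T.SpecTensorTo.base q'), ?_, ?_, ?_, ?_, ?_⟩
  · exact fun h => hqq (specTensorTo_base_injective T (hinj h))
  · change (e.inv ≫ p₁).base (T.SpecTensorTo.base q) = T.x
    rw [hP.isoPullback_inv_fst]; exact T.fst_SpecTensorTo_apply q
  · change (e.inv ≫ p₁).base (T.SpecTensorTo.base q') = T.x
    rw [hP.isoPullback_inv_fst]; exact T.fst_SpecTensorTo_apply q'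
  · change (e.inv ≫ p₂).base (T.SpecTensorTo.base q) = T.y
    rw [hP.isoPullback_inv_snd]; exact T.snd_SpecTensorTo_apply q
  · change (e.inv ≫ p₂).base (T.SpecTensorTo.base q') = T.y
    rw [hP.isoPullback_inv_snd]; exact T.snd_SpecTensorTo_apply q'

/-- **Mathlib's pushout ring `Triplet.tensor` is the tensor product of the residue fields**: for `y ∈ X¹`, `z₁ ∈ X_f`
with `σ z₁ = ρ y` and the triplet based at `ρ y`, `T.tensor ≅ κ(y) ⊗[κ(ρ y)] κ(z₁)` for the algebra structures
`ρ.residueFieldMap y : κ(ρ y) → κ(y)` and `κ(ρ y) ≅ κ(σ z₁) → κ(z₁)`. [folklore] -/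
theorem nonempty_tensor_iso_tensorProduct {y : X1} {z₁ : Xf} (h : σ.base z₁ = ρ.base y) :
    letI : Algebra (X.residueField (ρ.base y)) (X1.residueField y) := (ρ.residueFieldMap y).hom.toAlgebra
    letI : Algebra (X.residueField (ρ.base y)) (Xf.residueField z₁) :=
      ((X.residueFieldCongr h).inv ≫ σ.residueFieldMap z₁).hom.toAlgebra
    Nonempty ((⟨y, z₁, ρ.base y, rfl, h⟩ : Triplet ρ σ).tensor ≅
      CommRingCat.of (X1.residueField y ⊗[X.residueField (ρ.base y)] Xf.residueField z₁)) := by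
  letI : Algebra (X.residueField (ρ.base y)) (X1.residueField y) := (ρ.residueFieldMap y).hom.toAlgebra
  letI : Algebra (X.residueField (ρ.base y)) (Xf.residueField z₁) :=
    ((X.residueFieldCongr h).inv ≫ σ.residueFieldMap z₁).hom.toAlgebra
  have hT := CommRingCat.isPushout_tensorProduct (X.residueField (ρ.base y)) (X1.residueField y)
    (Xf.residueField z₁)
  -- the two spans agree
  have h1 : CommRingCat.ofHom (algebraMap (X.residueField (ρ.base y)) (X1.residueField y)) =
      (X.residueFieldCongr (rfl : ρ.base y = ρ.base y)).inv ≫ ρ.residueFieldMap y := by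
    rw [Scheme.residueFieldCongr_refl]; rfl
  have h2 : CommRingCat.ofHom (algebraMap (X.residueField (ρ.base y)) (Xf.residueField z₁)) =
      (X.residueFieldCongr h).inv ≫ σ.residueFieldMap z₁ := rfl
  exact ⟨(pushout.congrHom h1 h2).symm ≪≫ hT.isoPushout.symm⟩

/-- **(S2a-sch) — TWO PRIMES OF `κ(y) ⊗[κ(ρ y)] κ(z₁)` GIVE TWO POINTS OF THE FIBRE PRODUCT OVER `(y, z₁)`.**  For a
cartesian square `P → X¹, P → X_f` over `ρ, σ` and points `y ∈ X¹`, `z₁ ∈ X_f` over the same point of `X`: if the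
ring `κ(y) ⊗[κ(ρ y)] κ(z₁)` has two distinct prime ideals (res-D-pv-039's (S2a)), then `P` has two distinct points
`y₁ ≠ y₂` lying over `y` and over `z₁`. [cite: StacksProject, Tag 01JT] -/
theorem exists_ne_over_of_isPullback_of_primeSpectrum {P : Scheme.{u}} {p₁ : P ⟶ X1} {p₂ : P ⟶ Xf}
    (hP : IsPullback p₁ p₂ ρ σ) {y : X1} {z₁ : Xf} (h : σ.base z₁ = ρ.base y)
    (htwo : letI : Algebra (X.residueField (ρ.base y)) (X1.residueField y) := (ρ.residueFieldMap y).hom.toAlgebra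
      letI : Algebra (X.residueField (ρ.base y)) (Xf.residueField z₁) :=
        ((X.residueFieldCongr h).inv ≫ σ.residueFieldMap z₁).hom.toAlgebra
      ∃ q q' : PrimeSpectrum (X1.residueField y ⊗[X.residueField (ρ.base y)] Xf.residueField z₁), q ≠ q') :
    ∃ y₁ y₂ : P, y₁ ≠ y₂ ∧ p₁.base y₁ = y ∧ p₁.base y₂ = y ∧ p₂.base y₁ = z₁ ∧ p₂.base y₂ = z₁ := by
  letI : Algebra (X.residueField (ρ.base y)) (X1.residueField y) := (ρ.residueFieldMap y).hom.toAlgebra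
  letI : Algebra (X.residueField (ρ.base y)) (Xf.residueField z₁) :=
    ((X.residueFieldCongr h).inv ≫ σ.residueFieldMap z₁).hom.toAlgebra
  obtain ⟨e⟩ := nonempty_tensor_iso_tensorProduct (ρ := ρ) (σ := σ) h
  obtain ⟨q, q', hqq⟩ := htwo
  set T : Triplet ρ σ := ⟨y, z₁, ρ.base y, rfl, h⟩ with hT
  -- transport the two primes to `Spec T.tensor` along the isomorphism
  let φ := (Spec.map e.hom).base
  have hφ : Function.Injective φ := (TopCat.homeoOfIso (Scheme.forgetToTop.mapIso (Scheme.Spec.mapIso e.op))).injective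
  have hne : φ q ≠ φ q' := fun hh => hqq (hφ hh)
  exact exists_ne_over_of_isPullback hP T hne

end FibrePoints

end Summit.ResolutionOfSingularities.ResolutionOfSingularities.Theorems.NoZeno.ExcCount

end
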